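import Summits.BirchSwinnertonDyer.BirchSwinnertonDyer.Theorems.KolyvaginRoadThreeMethod2KolyvaginPerfCore
import HarnessLib

/-!
# Route `AdditiveKolyvaginRoad`, crux `KolyvaginPrimitiveAdditive` (item stmt-BirchSwinnertonDyer-20132):
# stub LOC, input (Perf) at a general odd prime `p` — RANK-ONE CUP-PRODUCT COCYCLES and the CHARACTER IDENTITY on
# `Γ_{K_v}` (second layer of the port of zhang3-p1's (Perf))
# (cell `pub/bsd-wall`, lead prover `bsd-wall-akr-p1` g3; `--supports stmt-BirchSwinnertonDyer-20132`, helper;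
# p-generic port of zhang3-p1's `Theorems/KolyvaginRoadThreeMethod2KolyvaginPerfCore.lean`, `3 ↦ p`)

WHY THIS FILE. The (Perf) non-vanishing at a Kolyvagin prime (`…KolyvaginPerf` at `p = 3`) is a STRUCTURAL argument on
rank-one cocycles: zhang3-p1's `PerfCore` supplies its two abstract steps with the prime `3` hard-coded. This file is
their port to an arbitrary prime `p` (the cocycle lemmas of `…PerfCocycles` are prime-free and reused by import).

WHAT.
* `twoCocycleClass_eq_zero_of_symmetric_odd` — a symmetric bi-additive `2`-cocycle of ODD exponent is a coboundary
  (coboundary of `-k·B(fσ,fσ)`, `p = 2k+1`; zhang3-p1's exponent-`3` lemma generalised);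
* `nsmul_eq_nsmul_of_nsmul_eq_P` — `k • w` only depends on `k • P` for `P` of order `p` and `p • w = 0`;
* `twoCocycleClass_ne_zero_of_rank_one_P` — for a continuous additive `f : G → M` of rank one (`f σ = k_σ P`, `P` of
  order `p`, `pM = 0`) and two continuous `2`-cocycles `c(σ,τ) = k_σ·n(τ)`, `c'(σ,τ) = k_σ·m(τ)` with values in a
  `p`-torsion `Z`, a character identity `m − j·n = k·w₀` (`w₀` fixed) gives `[c'] = j[c]`, so `[c'] ≠ 0 ⟹ [c] ≠ 0`;
* `exists_sub_zsmul_eq_nsmul_P` — the character identity on `Γ_{K_v}` at a finite place `v ∤ p` with a uniformiser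
  in `K`: `τ = g_F^{k'} g_i g_u`, tame factorisation of `(n, m)` on the inertia group
  (`InertiaTame.exists_forall_apply_eq_nsmul`), `n` ramified so `μ_p = ℤ n₁`.
Proofs = zhang3-p1's with `3 ↦ p` (`ZMod p`, `#μ_p = p`).

HONEST FRAMING: theorems only; 0 definitions, 0 named facts, 0 `sorry`; closes nothing.

References: [cite: MazurRubin2004, Prop. 1.3.2 (proof)] [cite: NeukirchANT1999, I §9 Prop. (9.4)]
[cite: SerreLocalFields1979, IV §2].
-/

-- single-conjunct summit: `Summit.BirchSwinnertonDyer.BirchSwinnertonDyer.…` repeats the name by design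
set_option linter.dupNamespace false

noncomputable section

open scoped Classical Pointwise

namespace Summit.BirchSwinnertonDyer.BirchSwinnertonDyer.Theorems.AdditiveKoly

open CategoryTheory WeierstrassCurve Field Function NumberField IsDedekindDomain
open Literature.NumberTheory.EllipticCurves Literature.NumberTheory.GaloisRepresentations Module
open Literature.NumberTheory.GaloisRepresentations.DiscreteGaloisModule (mu MuCarrier)
open Literature.NumberTheory.GaloisCohomology
open Summit.BirchSwinnertonDyer.Rank1Residual.X11b.Three.Koly.Method2
open scoped ContRepresentation

universe u v

/-! ## §0 A symmetric bi-additive `2`-cocycle of odd exponent is a coboundary -/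

/-- **A symmetric bi-additive `2`-cocycle of ODD exponent `p = 2k + 1` is a coboundary** (zhang3-p1's exponent-`3` lemma,
generalised): with `B` bi-additive, `B(f σ, f τ)` symmetric, killed by `p` and fixed by `G`, the cocycle
`(σ, τ) ↦ B(f σ, f τ)` is the coboundary of `b(σ) = k · B(f σ, f σ)`:
`b τ - b (στ) + b σ = -2k B(f σ, f τ) = (1 - p) B(f σ, f τ) = B(f σ, f τ)`. [cite: MazurRubin2004, Prop. 1.3.2 (proof)] -/
theorem twoCocycleClass_eq_zero_of_symmetric_odd {R : Type u} [CommRing R] [TopologicalSpace R]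
    {G : Type v} [Group G] [TopologicalSpace G] [IsTopologicalGroup G] [LocallyCompactSpace G] (Z : TopRep.{v} R G)
    {M : Type*} [AddCommGroup M] [TopologicalSpace M] [DiscreteTopology M]
    (f : C(G, M)) (hf : ∀ σ τ, f (σ * τ) = f σ + f τ) (B : M → M → Z)
    (hB₁ : ∀ a a' b, B (a + a') b = B a b + B a' b) (hB₂ : ∀ a b b', B a (b + b') = B a b + B a b')
    (hsymm : ∀ σ τ, B (f σ) (f τ) = B (f τ) (f σ)) (k : ℕ) (hodd : ∀ σ τ, (2 * k + 1) • B (f σ) (f τ) = 0)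
    (hfix : ∀ g σ τ, Z.ρ g (B (f σ) (f τ)) = B (f σ) (f τ))
    (c : contTwoCocycles Z) (hc : ∀ σ τ, c.1 (σ, τ) = B (f σ) (f τ)) : twoCocycleClass Z c = 0 := by
  rw [twoCocycleClass_eq_zero_iff]
  refine ⟨⟨fun σ ↦ (k : ℤ) • B (f σ) (f σ),
    (continuous_of_discreteTopology (f := fun m : M ↦ (k : ℤ) • B m m)).comp f.continuous⟩, fun σ τ ↦ ?_⟩
  change c.1 (σ, τ) = Z.ρ σ ((k : ℤ) • B (f τ) (f τ)) - (k : ℤ) • B (f (σ * τ)) (f (σ * τ)) +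
    (k : ℤ) • B (f σ) (f σ)
  rw [hc, map_zsmul, hfix, hf]
  simp only [hB₁, hB₂]
  rw [hsymm τ σ]
  -- `(2k+1) • B = 0`, so `B = -(2k) • B`, which is the right-hand side
  have h1 : B (f σ) (f τ) + (2 * (k : ℤ)) • B (f σ) (f τ) = 0 := by
    have h := hodd σ τ
    rw [← natCast_zsmul] at h
    calc B (f σ) (f τ) + (2 * (k : ℤ)) • B (f σ) (f τ) = ((2 * k + 1 : ℕ) : ℤ) • B (f σ) (f τ) := by
          push_cast; rw [add_zsmul, one_zsmul, add_comm]
      _ = 0 := h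
  linear_combination (norm := module) h1

/-! ## §1 Rank-one cup-product cocycles -/

/-- `k • w` only depends on `k • P` for `P` of order `p` and `p • w = 0`. [folklore] -/
theorem nsmul_eq_nsmul_of_nsmul_eq_P {p : ℕ} {A B : Type*} [AddCommGroup A] [AddCommGroup B] {P : A}
    (hP : addOrderOf P = p) {w : B} (hw : (p : ℕ) • w = 0) {k k' : ℕ} (h : k • P = k' • P) : k • w = k' • w := by
  have hmod : k ≡ k' [MOD p] := by rw [← hP]; exact nsmul_eq_nsmul_iff_modEq.mp h
  have hred : ∀ m : ℕ, m • w = (m % p) • w := fun m ↦ by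
    conv_lhs => rw [← Nat.mod_add_div m p, add_nsmul, mul_nsmul, hw, nsmul_zero, add_zero]
  rw [hred k, hred k', hmod]

/-- **Rank-one cup-product cocycles: `[c'] ≠ 0 ⟹ [c] ≠ 0`** (any prime `p`). Let `f : G → M` be continuous additive with
`f σ = k_σ P`, `P` of order `p` (`M` any `ZMod p`-module: an instance binder), and `c, c'` continuous `2`-cocycles with values in a `p`-torsion `Z` of the
shape `c(σ, τ) = k_σ · n(τ)`, `c'(σ, τ) = k_σ · m(τ)`; if `m τ - j · n τ = k_τ · w₀` for a `G`-fixed `w₀`, then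
`c' - j·c = (σ, τ) ↦ k_σ k_τ w₀` is a coboundary (`twoCocycleClass_eq_zero_of_symmetric`), so `[c'] = j [c]`.
[cite: MazurRubin2004, Prop. 1.3.2 (proof)] -/
theorem twoCocycleClass_ne_zero_of_rank_one_P {p : ℕ} [Fact p.Prime] {G : Type v} [Group G] [TopologicalSpace G]
    [IsTopologicalGroup G] [LocallyCompactSpace G] (Z : TopRep.{v} ℤ G) {M : Type*} [AddCommGroup M]
    [TopologicalSpace M] [DiscreteTopology M] [Module (ZMod p) M]
    (f : C(G, M)) (hf : ∀ σ τ, f (σ * τ) = f σ + f τ) {P : M} (hPp : addOrderOf P = p)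
    (hrank : ∀ σ, ∃ k : ℕ, f σ = k • P) (n m : G → Z) (c c' : contTwoCocycles Z)
    (hc : ∀ σ τ (k : ℕ), f σ = k • P → c.1 (σ, τ) = k • n τ)
    (hc' : ∀ σ τ (k : ℕ), f σ = k • P → c'.1 (σ, τ) = k • m τ)
    (hpZ : ∀ z : Z, p • z = 0) {j : ℤ} {w₀ : Z} (hw₀ : ∀ g, Z.ρ g w₀ = w₀)
    (hkey : ∀ τ (k : ℕ), f τ = k • P → m τ - j • n τ = k • w₀) (hp2 : p ≠ 2)
    (hne : twoCocycleClass Z c' ≠ 0) : twoCocycleClass Z c ≠ 0 := by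
  have hp : p.Prime := Fact.out
  haveI : NeZero p := ⟨hp.ne_zero⟩
  obtain ⟨kp, hkp⟩ : ∃ kp, p = 2 * kp + 1 := hp.odd_of_ne_two hp2
  letI : Module (ZMod p) Z := AddCommGroup.zmodModule hpZ
  have hP0 : P ≠ 0 := fun h0 ↦ by rw [h0, addOrderOf_zero] at hPp; exact hp.one_lt.ne' hPp.symm
  obtain ⟨π, hπ⟩ := Module.Projective.exists_dual_eq_one (ZMod p) hP0
  have hπk : ∀ {g} {k : ℕ}, f g = k • P → π (f g) = (k : ZMod p) := fun {g k} hk ↦ by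
    rw [hk, map_nsmul, hπ, nsmul_eq_mul, mul_one]
  have hzmod : ∀ (a : ZMod p) (z : Z), a • z = a.val • z := fun a z ↦ by
    conv_lhs => rw [← ZMod.natCast_zmod_val a]
    rw [Nat.cast_smul_eq_nsmul]
  have hc₀ : twoCocycleClass Z (c' - j • c) = 0 := by
    refine twoCocycleClass_eq_zero_of_symmetric_odd Z f hf (fun a b ↦ (π a * π b) • w₀)
      (fun a a' b ↦ by simp only [map_add, add_mul, add_smul]) (fun a b b' ↦ by simp only [map_add, mul_add, add_smul])
      (fun σ τ ↦ by rw [mul_comm]) kp (fun σ τ ↦ by rw [← hkp]; exact hpZ _)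
      (fun g σ τ ↦ by rw [hzmod, map_nsmul, hw₀]) _ fun σ τ ↦ ?_
    obtain ⟨kσ, hkσ⟩ := hrank σ
    obtain ⟨kτ, hkτ⟩ := hrank τ
    change c'.1 (σ, τ) - j • c.1 (σ, τ) = (π (f σ) * π (f τ)) • w₀
    rw [hc' σ τ kσ hkσ, hc σ τ kσ hkσ, hπk hkσ, hπk hkτ, mul_smul, Nat.cast_smul_eq_nsmul, Nat.cast_smul_eq_nsmul,
      ← hkey τ kτ hkτ, smul_sub, smul_comm kσ j]
  have hsm : twoCocycleClass Z (j • c) = j • twoCocycleClass Z c := map_zsmul (twoCocycleClassₗ Z) j c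
  have hcls : twoCocycleClass Z c' = j • twoCocycleClass Z c := by
    rw [twoCocycleClass_sub, hsm, sub_eq_zero] at hc₀
    exact hc₀
  intro h0
  apply hne
  rw [hcls, h0]
  exact zsmul_zero j

/-! ## §2 The character identity on `Γ_{K_v}`, general `p` -/

section Place

variable (K : Type) [Field K] [NumberField K] (v : HeightOneSpectrum (𝓞 K)) (p : ℕ) [Fact p.Prime]

/-- **The character identity `m = j·n + k·w₀` on `Γ_{K_v}`** at a finite place `v ∤ p` with a uniformiser `π₀ ∈ K`:
`F` an arithmetic Frobenius at the prime `𝔓 ∣ v` cut out by the chosen embedding, `g_F ∈ Γ_{K_v}` a lift,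
`f : Γ_{K_v} → M` continuous additive, killing the preimage of `I_𝔓`, with `f(g_F)` of order `p`, and
`n, m : Γ_{K_v} → μ_p(K̄)` continuous additive with `n` ramified. Then there are `j ∈ ℤ`, `w₀ ∈ μ_p` with
`m τ - j · n τ = k · w₀` whenever `f τ = k · f(g_F)`. Proof = zhang3-p1's with `3 ↦ p`.
[cite: NeukirchANT1999, I §9 Prop. (9.4)] [cite: SerreLocalFields1979, IV §2] -/
theorem exists_sub_zsmul_eq_nsmul_P {𝔐 : Ideal (HeightOneSpectrum.localAbsIntegers v)} (h𝔐 : 𝔐 ∈ v.localPrimesAbove)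
    (hpv : ((p ^ 1 : ℕ) : 𝓞 K) ∉ v.asIdeal) {π₀ : K} (hπ₀ : v.valuation K π₀ = WithZero.exp (-1 : ℤ))
    {F : absoluteGaloisGroup K} (hF : IsArithFrobAt (𝓞 K) F (v.primeBelow (closureEmb (K := K) (v.adicCompletion K)) 𝔐))
    {gF : absoluteGaloisGroup (v.adicCompletion K)} (hgF : absGaloisRestrict K (v.adicCompletion K) gF = F)
    {M : Type*} [AddCommGroup M] [TopologicalSpace M] [DiscreteTopology M]
    (f : C(absoluteGaloisGroup (v.adicCompletion K), M)) (hf : ∀ g g', f (g * g') = f g + f g')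
    (hfI : ∀ g, absGaloisRestrict K (v.adicCompletion K) g ∈
      (v.primeBelow (closureEmb (K := K) (v.adicCompletion K)) 𝔐).inertia (absoluteGaloisGroup K) → f g = 0)
    (hPp : addOrderOf (f gF) = p)
    (n m : C(absoluteGaloisGroup (v.adicCompletion K), MuCarrier K (p ^ 1)))
    (hn : ∀ g g', n (g * g') = n g + n g') (hm : ∀ g g', m (g * g') = m g + m g')
    (hram : ∃ g, absGaloisRestrict K (v.adicCompletion K) g ∈
      (v.primeBelow (closureEmb (K := K) (v.adicCompletion K)) 𝔐).inertia (absoluteGaloisGroup K) ∧ n g ≠ 0) :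
    ∃ (j : ℤ) (w₀ : MuCarrier K (p ^ 1)), ∀ (τ : absoluteGaloisGroup (v.adicCompletion K)) (k : ℕ),
      f τ = k • f gF → m τ - j • n τ = k • w₀ := by
  have hp : p.Prime := Fact.out
  set Kv := v.adicCompletion K with hKv
  set D := (v.primeBelow (closureEmb (K := K) Kv) 𝔐).decompositionSubgroup (absoluteGaloisGroup K) with hDdef
  set I := (v.primeBelow (closureEmb (K := K) Kv) 𝔐).inertia (absoluteGaloisGroup K) with hIdef
  have h𝔓 : v.primeBelow (closureEmb (K := K) Kv) 𝔐 ∈ v.primesAbove := HeightOneSpectrum.primeBelow_mem_primesAbove h𝔐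
  have hinj : Injective (absGaloisRestrict K Kv) := absGaloisRestrict_adicCompletion_injective K v
  have hres : ∀ g : absoluteGaloisGroup Kv, absGaloisRestrict K Kv g ∈ D := fun g ↦ by
    rw [hDdef, ← resGal_eq_absGaloisRestrict, resGal_eq]; exact resGalOfEmb_mem_decompositionSubgroup _ h𝔐 g
  have hID : I ≤ D := Ideal.inertia_le_stabilizer _
  -- `μ_p`: `p`-torsion, of order `p`
  have hp1μ : ∀ z : MuCarrier K (p ^ 1), (p ^ 1) • z = p • z := fun z ↦ congrArg (fun k : ℕ ↦ k • z) (pow_one p)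
  have hμp : ∀ z : MuCarrier K (p ^ 1), p • z = 0 := fun z ↦ by
    rw [← hp1μ, ← natCast_zsmul]
    exact zsmul_muCarrier_eq_zero K (p ^ 1) z
  have hcmu : Nat.card (MuCarrier K (p ^ 1)) = p := by
    change Nat.card (rootsOfUnity (p ^ 1) (AlgebraicClosure K)) = p
    haveI : NeZero (p ^ 1 : ℕ) := ⟨pow_ne_zero 1 hp.ne_zero⟩
    rw [HasEnoughRootsOfUnity.natCard_rootsOfUnity, pow_one]
  haveI : Finite (MuCarrier K (p ^ 1)) := Nat.finite_of_card_ne_zero (by rw [hcmu]; exact hp.ne_zero)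
  -- additive maps vanish at `1` and on powers
  have h1 : ∀ (θ : C(absoluteGaloisGroup Kv, MuCarrier K (p ^ 1))), (∀ τ τ', θ (τ * τ') = θ τ + θ τ') → θ 1 = 0 :=
    fun θ hθ ↦ by have h := hθ 1 1; rw [mul_one] at h; exact left_eq_add.mp h
  have hpow : ∀ (θ : C(absoluteGaloisGroup Kv, MuCarrier K (p ^ 1))), (∀ τ τ', θ (τ * τ') = θ τ + θ τ') →
      ∀ N : ℕ, θ (gF ^ N) = N • θ gF := by
    intro θ hθ N
    induction N with
    | zero => rw [pow_zero, h1 θ hθ, zero_smul]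
    | succ N ih => rw [pow_succ gF N, hθ, ih, succ_nsmul]
  have hf1 : f 1 = 0 := by have h := hf 1 1; rw [mul_one] at h; exact left_eq_add.mp h
  have hpow_f : ∀ N : ℕ, f (gF ^ N) = N • f gF := fun N ↦ by
    induction N with
    | zero => rw [pow_zero, hf1, zero_smul]
    | succ N ih => rw [pow_succ gF N, hf, ih, succ_nsmul]
  -- ### the continuous lift `L : D → Γ_{K_v}` and the pair `a = (n, m) ∘ L` on `I_𝔓`
  obtain ⟨L, hLc, hL, hLmul⟩ := KolyLocal.exists_continuous_lift_decompositionSubgroup K v h𝔐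
  let a : I → MuCarrier K (p ^ 1) × MuCarrier K (p ^ 1) := fun i ↦ (n (L ⟨i, hID i.2⟩), m (L ⟨i, hID i.2⟩))
  have ha : ∀ i, a i = (n (L ⟨i, hID i.2⟩), m (L ⟨i, hID i.2⟩)) := fun _ ↦ rfl
  have hLi : Continuous fun i : I ↦ L ⟨i, hID i.2⟩ := hLc.comp (Continuous.subtype_mk continuous_subtype_val _)
  have hac : Continuous a := (n.continuous.comp hLi).prodMk (m.continuous.comp hLi)
  have haa : ∀ i i', a (i * i') = a i + a i' := fun i i' ↦ by
    rw [ha, ha, ha, Prod.mk_add_mk, ← hn, ← hm, ← hLmul]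
    rfl
  have hT : ∀ t : MuCarrier K (p ^ 1) × MuCarrier K (p ^ 1), (p ^ 1) • t = 0 := fun t ↦
    (congrArg (fun k : ℕ ↦ k • t) (pow_one p)).trans (Prod.ext (hμp t.1) (hμp t.2))
  have hp1pos : 0 < p ^ 1 := pow_pos hp.pos 1
  obtain ⟨z, hz⟩ := IsAlgClosed.exists_pow_nat_eq (algebraMap K (AlgebraicClosure K) π₀) hp1pos
  obtain ⟨σ₁, -, hσ₁⟩ := InertiaTame.exists_forall_apply_eq_nsmul v hp1pos hpv hπ₀ hz h𝔓 hT a hac haa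
  set n₁ := n (L ⟨σ₁, hID σ₁.2⟩) with hn₁def
  set m₁ := m (L ⟨σ₁, hID σ₁.2⟩) with hm₁def
  have ha₁ : a σ₁ = (n₁, m₁) := ha σ₁
  -- `n` ramified ⟹ `n₁ ≠ 0`
  have hn₁ : n₁ ≠ 0 := by
    obtain ⟨g, hgI, hg0⟩ := hram
    intro h0
    apply hg0
    obtain ⟨kᵢ, hkᵢ⟩ := hσ₁ ⟨_, hgI⟩
    have hg : L ⟨absGaloisRestrict K Kv g, hID hgI⟩ = g := hinj (hL _)
    have h1 : (a ⟨_, hgI⟩).1 = n g := by rw [ha]; change n (L ⟨absGaloisRestrict K Kv g, _⟩) = n g; rw [hg]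
    rw [← h1, hkᵢ, ha₁, Prod.smul_fst, h0, smul_zero]
  -- `μ_p = ℤ n₁`, `m₁ = j n₁`
  obtain ⟨j, hj⟩ : ∃ j : ℤ, j • n₁ = m₁ := by
    have hord : addOrderOf n₁ = p := addOrderOf_eq_prime (hμp n₁) hn₁
    have htop : AddSubgroup.zmultiples n₁ = ⊤ :=
      AddSubgroup.eq_top_of_card_eq _ (by rw [Nat.card_zmultiples, hord, hcmu])
    exact AddSubgroup.mem_zmultiples_iff.mp (htop ▸ AddSubgroup.mem_top m₁)
  refine ⟨j, m gF - j • n gF, fun τ k hk ↦ ?_⟩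
  -- ### decompose `τ = g_F ^ k' · g_i · g_u`
  have hO : IsOpen (n ⁻¹' {0} ∩ m ⁻¹' {0} ∩ f ⁻¹' {0}) :=
    (((isOpen_discrete ({0} : Set (MuCarrier K (p ^ 1)))).preimage n.continuous).inter
      ((isOpen_discrete ({0} : Set (MuCarrier K (p ^ 1)))).preimage m.continuous)).inter
      ((isOpen_discrete ({0} : Set M)).preimage f.continuous)
  have h1O : (1 : absoluteGaloisGroup Kv) ∈ n ⁻¹' {0} ∩ m ⁻¹' {0} ∩ f ⁻¹' {0} := ⟨⟨h1 n hn, h1 m hm⟩, hf1⟩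
  obtain ⟨U, hU, hUO⟩ := KolyLocal.exists_isOpen_subgroup_absGaloisRestrict_mem K v hO h1O
  obtain ⟨k', i', u, hi', hu, hdec⟩ := exists_eq_frobenius_pow_mul_of_mem_decompositionSubgroup h𝔓 hF hU (hres τ)
  set gi := L ⟨i', hID hi'⟩ with hgidef
  have hgi : absGaloisRestrict K Kv gi = i' := hL _
  set gu := (gF ^ k' * gi)⁻¹ * τ with hgudef
  have hgu : absGaloisRestrict K Kv gu = u := by
    rw [hgudef, map_mul, map_inv, map_mul, map_pow, hgF, hgi, hdec, inv_mul_cancel_left]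
  have hτ : τ = gF ^ k' * gi * gu := by rw [hgudef, mul_inv_cancel_left]
  obtain ⟨⟨hnu, hmu⟩, hfu⟩ := hUO gu (hgu ▸ hu)
  have hfi : f gi = 0 := hfI gi (by rw [hgi]; exact hi')
  have hfτ : f τ = k' • f gF := by rw [hτ, hf, hf, hpow_f, hfi, hfu, add_zero, add_zero]
  obtain ⟨kᵢ, hkᵢ⟩ := hσ₁ ⟨i', hi'⟩
  rw [ha, ha₁] at hkᵢ
  have hngi : n gi = kᵢ • n₁ := by have := congrArg Prod.fst hkᵢ; rwa [Prod.smul_fst] at this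
  have hmgi : m gi = kᵢ • m₁ := by have := congrArg Prod.snd hkᵢ; rwa [Prod.smul_snd] at this
  have hnτ : n τ = k' • n gF + kᵢ • n₁ := by rw [hτ, hn, hn, hpow n hn, hngi, hnu, add_zero]
  have hmτ : m τ = k' • m gF + kᵢ • m₁ := by rw [hτ, hm, hm, hpow m hm, hmgi, hmu, add_zero]
  have hkk' : k • (m gF - j • n gF) = k' • (m gF - j • n gF) :=
    nsmul_eq_nsmul_of_nsmul_eq_P hPp (hμp _) (hk.symm.trans hfτ)
  rw [hkk', hnτ, hmτ, ← hj]
  module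

end Place

end Summit.BirchSwinnertonDyer.BirchSwinnertonDyer.Theorems.AdditiveKoly

end
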